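import Mathlib
import HarnessLib
import HarnessLib.Audit
import Summits.AtomisticToContinuum.Statement
import Summits.AtomisticToContinuum.HydrodynamicLimit.Theorems.ImplosionDichotomyHsEosLowDensity
import HarnessLib.Audit.Status.Attr

/-!
Route: InvariantGibbsBookkeeping

DORMANT since 2026-08-22T17:47:04Z (reconciler: no traction for 5.5 d (last activity item-evidence-added at 2026-08-17T04:20:05Z); parked, not closed — `ledger route dormant route-AtomisticToContinuum-InvariantGibbsBookkeeping --off` to) — unstaffed, not closed; items shared with open routes are served there. `ledger route dormant <id> --off` reactivates.

# Route InvariantGibbsBookkeeping — entropy booked against the invariant Gibbs law — free second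
law, flux locality on good events, finite-N Dafermos Gronwall to Euler

X = MacroSecondLaw ∧ MomentumFluxLocality ∧ EnergyFluxLocality ∧ NoConcentration ∧
ModulatedEntropyStability ("it suffices to
show"; card invariant-gibbs-entropy-bookkeeping, spine; conforming D-0027 §2.1 successor of route
EntropyBookkeeping, retired
2026-08-15 only because its Assembly named the Literature constant instead of the sub-problem decl).
(i) MacroSecondLaw: for
local-Gibbs hard-sphere data at small reduced density σ, the φ-coarse-grained mathematical entropy
∫η_σ(U_N⋆φ)dx after ANY measurable
Liouville- and energy-preserving map Ψ_N exceeds its initial (LLN-profile) value by κ only with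
vanishing probability, on the event of
a coarse density floor — no dynamics, only the exponential tilt LG = e^{NΛ(U_N)}·G of the invariant
Gibbs law G and static large
deviations. (ii)/(iii) Momentum/EnergyFluxLocality: pre-shock and ON THE GOOD EVENT that the
φ-coarse fields stay in a compact
non-degenerate state box (density in [λ,Λ], energy ≤ M, temperature ≥ λ, Λσ³ ≤ η₀), the empirical
momentum / energy increments over
[0,t] tested against a smooth χ equal the time-integrated hs-Euler fluxes of the coarse fields,
error → 0 in probability as N → ∞
at every small macroscopic resolution r. (iv) NoConcentration: the good event is typical — coarse
density, energy and temperature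
stay within a factor c of the classical solution's range uniformly on [0,t]×𝕋³. (v)
ModulatedEntropyStability: the finite-N
Dafermos / modulated-entropy Gronwall (a PDE-and-measure theorem typed as an implication) turns
(i)–(iv) and the PROVED
low-density EOS fact into the packing-guarded conjunct — which, since the statement re-type of
2026-08-16 (D-0032, retype
hydro2, p126922), IS the sub-problem decl `HydrodynamicLimit` verbatim; the isentropy of the
classical solution is proved INSIDE
the crux (the support EulerIsentropic is its pre-cut lemma, no longer an antecedent); the deciding
theorem `closes` is crux-only
pure application (route-repair gen 3, 2026-08-16; sorry-free, axioms standard).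
Lean: `MacroSecondLaw ∧ MomentumFluxLocality ∧ EnergyFluxLocality ∧ NoConcentration ∧
ModulatedEntropyStability`

## Assembly
Crux-only pure application, proved sorry-free as the deciding theorem `closes` (glue.lean;
route-repair gen 3 of 2026-08-16; lean
check rc 0, axioms propext / Classical.choice / Quot.sound): `closes hSL hM hE hNC hStab := hStab
HsEosLowDensity_holds hSL hM hE hNC`
— ModulatedEntropyStability applied to the PROVED support HsEosLowDensity (its landed witness
`HsEosLowDensity_holds`, a lemma
invoked inside the term, not a hypothesis) and to the four cruxes MacroSecondLaw,
MomentumFluxLocality, EnergyFluxLocality,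
NoConcentration yields EXACTLY `∃ η₀ > 0, ∀ profiles, ∃ σ₀, ∀ σ < σ₀, ∀ classical solutions on [0,T)
with ρσ³ < η₀ throughout,
∀ flows, LLN at 0 ⇒ LLN at every t < T`, the re-typed sub-problem decl `HydrodynamicLimit`
(δ-unfolding of the def and of T3 / V3).
Hypotheses of `closes` = the five cruxes, nothing else. The isentropy of classical solutions —
formerly antecedent 6 of
ModulatedEntropyStability and hypothesis `hIso : EulerIsentropic` of `closes` (gate lint
glue.non-crux-hypothesis) — is since this
repair a step INSIDE the crux: ModulatedEntropyStability is restated without that antecedent (a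
strengthening by exactly
EulerIsentropic: new → old by ignoring it, old ∧ EulerIsentropic → new; Sketch.lean), and the
support EulerIsentropic (C²-F form,
provable now, M) stays filed as its pre-cut lemma for any idle prover (`EulerIsentropic_holds` once
landed). The packing guard is a
hypothesis INSIDE the Statement, so the shared support DiluteSelfConsistency
(stmt-AtomisticToContinuum-3091) is not an item of this
route (dropped 2026-08-16; it stays on its other routes); `Assembly` is restated to the
five-antecedent shape of `closes`.
MassTransport, HsEntropyConvex, EulerIsentropic are lemmas for the prover of
ModulatedEntropyStability and LlnImpliesRelEntropy is the
route's hub-fact deliverable; none of the four is a hypothesis of `closes`.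

Rationale: WHY THIS LINE. The local Gibbs law is an exponential tilt, LINEAR in the empirical conserved fields,
of the flow-INVARIANT global Gibbs law G_N (Spohn1991 §7.1 (7.16); Sasa2014; Gaspard2022
(3.40)–(3.47)), so entropy booked against G_N makes the macroscopic second law a STATIC
large-deviation fact valid for every Liouville- and energy-preserving map (Georgii1994, Georgii1995,
GeorgiiZessin1993 LDP; RoeckMaesNetocny2006 prove H-theorems this way GIVEN an autonomous
macroscopic equation — none assumed here; GoldsteinLebowitz2004), and Dafermos1979's
relative-entropy stability on 𝕋³ consumes only this GLOBAL inequality plus the conservation laws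
tested against the smooth multipliers Dη_σ(Ū) (Dafermos2005 §5.2). Imported areas: hyperbolic
conservation laws (relative entropy / weak–strong stability) and the mean-field modulated-energy
technology (Serfaty2020; HanKwanIacobelli2021: Euler from Newton by a finite-N Gronwall against the
smooth solution), transplanted to collisional hard spheres with THERMAL pressure, where the
modulated quantity is the full convex entropy η_σ = −ρs and its one inequality comes free from
invariance. Versus the open board: AnnealedZeroHorizon is the ANNEALED twin (mean flux closure at
all times, mean second law, FLMW statistical weak–strong in expectation); this route is QUENCHED,
finite-N — closure only pre-shock and only on good events (decoupled from a-priori control, which is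
its own necessary crux NoConcentration), second law for ARBITRARY measure-preserving maps with a
density floor (the form an adversary cannot beat), pathwise Gronwall on the good event;
BoxDissipativeWeakStrong needs a LOCAL clamped entropy inequality (a hidden weak local-equilibrium
statement), unnecessary on 𝕋³ by this line; the negatives index is steered around (see Barriers).

RANKED CRUXES. #2 MacroSecondLaw (crux) — MACROSCOPIC SECOND LAW WITHOUT DYNAMICS (card (i)–(ii)).
For continuous positive profiles there is σ₀ such that for σ < σ₀, every continuous positive triple
(ρ₁,u₁,θ₁) that is the time-0 LLN limit of the local-Gibbs fields, EVERY sequence of measurable maps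
Ψ_N of (N+1)-sphere phase space preserving the hard-sphere Liouville measure and the kinetic energy
a.e., every continuous kernel φ ≥ 0 with ∫φ = 1, every floor λ > 0 and κ > 0: P_LG([∀x, ρ_φ(Ψ_N
z)(x) ≥ λ] ∧ ∫η_σ(U(Ψ_N z)⋆φ)dx > ∫η_σ(ρ₁,ρ₁u₁,E(ρ₁,u₁,θ₁))dx + κ) → 0, where η_σ(ρ,m,E) = −ρ(3/2
log θ − log ρ − hsExcessFreeEnergy(ρσ³)), θ = ⅔(E/ρ − |m|²/2ρ²) on the φ-mollified empirical fields.
Mechanism: dLG/dG_β = e^{N'Λ(U_N)}/ratio, Λ linear in the empirical fields, G_β invariant under Ψ_N;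
LD upper bound for the mollified empirical field under the canonical hard-sphere state at ALL
densities, Laplace lower bound N'⁻¹log(Z_LG/Z_G) at the dilute profile, Jensen (η_σ convex), exact
energy conservation (the exponent is then β-independent); the density floor makes the coarse-entropy
functional continuous on finite-rate profiles (no isolated-cold-pair irregularity). [difficulty: L]
(why it might fail: Arbitrary Ψ_N are adversarial: any residual LD-irregularity of the floored
coarse-entropy functional (sub-extensive cold clusters above the floor, Bochner/log junk: log 0 = 0,
∫ = 0 if non-integrable, f_ex junk beyond close packing) lets a Liouville rearrangement beat the
profile-level bound.) [Georgii1994, Georgii1995, GeorgiiZessin1993, RoeckMaesNetocny2006, Sasa2014,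
GoldsteinLebowitz2004, Spohn1991, LebowitzPenrose1964] #3 MomentumFluxLocality (crux) —
MOMENTUM-FLUX LOCALITY ON GOOD EVENTS, PRE-SHOCK (card residual crux R). ∃ packing cap η₀ > 0 such
that for continuous positive profiles, σ < σ₀(profiles), every classical hs-Euler solution on [0,T)
whose t = 0 fields are the LLN limit of the local-Gibbs fields (the solution is only the CLOCK),
every t < T, smooth χ, box parameters λ > 0, Λ with Λσ³ ≤ η₀, M, and κ > 0 there is r > 0 such that
for every continuous kernel φ ≥ 0, ∫φ = 1, supported in the sup-ball B_r(0): P_LG( GOOD ∧ ‖M_N(Φ_t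
z)(χ) − M_N(Φ_0 z)(χ) − ∫_0^t∫_𝕋³[(m_φ·∇χ)m_φ/ρ_φ + hsPressure σ ρ_φ θ_φ ∇χ](Φ_τ z, x)dx dτ‖ > κ ) →
0, where GOOD = [∀τ ∈ [0,t] ∀x: λ ≤ ρ_φ ≤ Λ, e_φ ≤ M, θ_φ ≥ λ] for the φ-coarse fields (ρ_φ,m_φ,e_φ)
along the trajectory and θ_φ = ⅔(e_φ/ρ_φ − |m_φ|²/2ρ_φ²). Content: the time-integrated kinetic
stress → ρ_φu_φ⊗u_φ + ρ_φθ_φ𝟙 and collisional transfer → ρθ(Z(ρσ³) − 1)𝟙 (virial theorem at contact)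
at every positive macroscopic resolution, GIVEN a-priori bounds; time averaging over the ≍ N^{1/3}
collisions per particle is the lever. Necessary for the conjunct: a refutation bears on the conjunct
itself. [difficulty: open-problem] (why it might fail: It IS local equilibrium of the momentum
current at fixed σ > 0: persistent mesoscopic position–velocity (ring/recollision) correlations
before T could shift the time-averaged collisional transfer off ρθ(Z−1)𝟙; no mixing theorem for
deterministic spheres exists (Spohn1991 I.3 p. 44).) [Spohn1991, OllaVaradhanYau1993,
KipnisLandim1999, NachtergaeleYau2003,
Literature.Barriers.AtomisticToContinuum.BoltzmannHypothesisBarrierNarrow] #4 EnergyFluxLocality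
(crux) — ENERGY-FLUX LOCALITY ON GOOD EVENTS, PRE-SHOCK (the HighMomentumCutoff-carrying half of the
closure). Same frame, quantifiers and GOOD event as MomentumFluxLocality, for the empirical ENERGY
field E_N: P_LG( GOOD ∧ |E_N(Φ_t z)(χ) − E_N(Φ_0 z)(χ) − ∫_0^t∫_𝕋³ (e_φ + hsPressure σ ρ_φ
θ_φ)(m_φ·∇χ)/ρ_φ (Φ_τ z, x)dx dτ| > κ ) → 0: the time-integrated microscopic energy current (kinetic
part (N+1)⁻¹Σ_i(v_i·∇χ)|v_i|²/2, a CUBIC velocity moment, plus collisional transfer) is the hs-Euler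
enthalpy flux (E+p)u of the coarse state with ZERO Euler-order heat flux. Only bounded quantities
appear (increments of the conserved energy field, fluxes inside the good box); the cubic tail lives
inside the proof (OVY93 modified the kinetic energy to avoid it); necessary for the conjunct.
[difficulty: open-problem] (why it might fail: Needs control of the cubic velocity moment of the
microscopic energy current along the evolved law (HighMomentumCutoff barrier; OVY93 §1 modified the
kinetic energy; Nachtergaele–Yau Assumption II.1 'no proof') AND a vanishing Euler-order heat flux
at fixed σ.) [OllaVaradhanYau1993, NachtergaeleYau2003, Spohn1991,
Literature.Barriers.AtomisticToContinuum.HighMomentumCutoffBarrier] #5 NoConcentration (crux) — NO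
COARSE-GRAINED CONCENTRATION, VACUUM OR COLD SPOT BEFORE T (the a-priori control making the good
events of the flux cruxes typical and the Gronwall constants uniform). For profiles, σ < σ₀, a
classical solution (ρ,u,θ) on [0,T) tied to the local-Gibbs data by the t = 0 LLN, t < T, c > 1 and
every continuous kernel φ ≥ 0 with ∫φ = 1: P_LG( ∃τ ∈ [0,t] ∃x: coarse density ρ_φ(Φ_τ z)(x) below
(inf ρ)/c, or above c·sup ρ, or coarse energy e_φ above c·sup E, or coarse temperature θ_φ below
(inf θ)/c — inf/sup over [0,t]×𝕋³, encoded as strict comparison with every value ρ(τ′,x′) etc.) → 0.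
Weaker than the conclusion at fixed times (LLN: ρ_φ → ρ̄⋆φ ∈ [inf,sup], θ(Ū⋆φ) ≥ inf θ̄ by concavity
of ρθ) but UNIFORM in (τ,x); on its complement the coarse state stays in a compact box where η_σ is
bounded, uniformly convex, and relative fluxes (incl. the cubic ½ρ|u−ū|²(u−ū)) are ≤ Cη_σ(·|Ū).
[difficulty: open-problem] (why it might fail: A macroscopic hot/cold spot, dilute fast stream or
coarse vacuum before T costs only finite entropy (affordable far from equilibrium), so only dynamics
excludes it; no a-priori maximum principle for coarse fields of deterministic spheres is known;
τ-uniformity needs collision-rate control.) [Dafermos1979, OllaVaradhanYau1993, Spohn1991,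
Literature.Barriers.AtomisticToContinuum.HighMomentumCutoffBarrier] #6 ModulatedEntropyStability
(crux) — THE FINITE-N DAFERMOS / MODULATED-ENTROPY GRONWALL, typed as the implication
HsEosLowDensity → MacroSecondLaw → MomentumFluxLocality → EnergyFluxLocality → NoConcentration →
HydrodynamicLimit-body (the PROVED support HsEosLowDensity inlined verbatim as antecedent 1, fed by
`HsEosLowDensity_holds` in `closes`; the conclusion VERBATIM the sub-problem decl
`HydrodynamicLimit`, the packing-guarded conjunct of re-type hydro2): ∃η₀ > 0 ∀ continuous positive
profiles ∃σ₀ ∀σ < σ₀ ∀ classical hs-Euler solutions on [0,T) with ρσ³ < η₀ throughout ∀ flow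
families, LLN of the fields at t = 0 ⇒ LLN at every t < T. Restated 2026-08-16 (route-repair gen 3)
WITHOUT the former antecedent 6 (isentropy = support EulerIsentropic inline): that step is proved
INSIDE, EulerIsentropic being its filed pre-cut lemma — a strengthening by exactly EulerIsentropic
(new → old; old ∧ EulerIsentropic → new, Sketch.lean). Intended proof (per σ, solution, t, χ, δ):
band below the EOS-analyticity / strict-convexity radius and the flux caps; mollifier reduction
U_N(t)(χ) − ∫χŪ(t) = U_N(χ − χ⋆φ̌) + ∫(U_N⋆φ − Ū)χ, so it suffices that ∫η_σ(U_N(t)⋆φ | Ū(t))dx =: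
H_φ(t) is small w.h.p. for small r; on the good event (c = 2 in NoConcentration) H_φ(τ) =
[∫η_σ(U_N⋆φ) − ∫η_σ(Ū(0))] − [∫η_σ(Ū(τ)) − ∫η_σ(Ū(0))] − L(τ), first bracket ≤ κ by MacroSecondLaw
with Ψ_N = Φ_τ (floor from the good event), second = 0 by isentropy (EulerIsentropic with the
analytic F of HsEosLowDensity), and L(τ) − L(0) computed from the flux cruxes with the smooth
multipliers Dη_σ(Ū) (time grid + Fubini over τ, mass exact by MassTransport) leaves |·| ≤ C∫_0^τ H_φ
+ o(1) + O(r) by the relative-flux bound |F(U) − F(Ū) − DF(Ū)(U−Ū)| ≤ Cη_σ(U|Ū) on the good box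
(HsEntropyConvex); Gronwall, then coercivity η_σ(U|Ū) ≥ c|U−Ū|² on the box. [deps: HsEosLowDensity,
MacroSecondLaw, MomentumFluxLocality, EnergyFluxLocality, NoConcentration; lemmas EulerIsentropic,
HsEntropyConvex, MassTransport] [difficulty: L] (why it might fail: Closure and second law hold only
at fixed times (in probability), so the Gronwall needs a Fubini/bad-time-set bookkeeping with H_φ
bounded on the good box, joint measurability of (τ,z) ↦ Φ_τ z, coercivity / relative-flux constants
uniform in the mollifier, and isentropy from the one-sided PDE clauses — unprinted at finite N.)
[Dafermos1979, Dafermos2005, BrezinaFeireisl2018, FjordholmEtAl2020, Serfaty2020,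
HanKwanIacobelli2021] #9 EulerIsentropic (support) — CLASSICAL hs-EULER SOLUTIONS ARE ISENTROPIC
WHERE THE EOS IS C² (provable now, M; the pre-cut LEMMA for the isentropy step inside
ModulatedEntropyStability — since route-repair gen 3 neither an antecedent of that crux nor a
hypothesis of `closes`; re-typed 2026-08-16 `ContDiffOn ℝ 1 F` → `ContDiffOn ℝ 2 F` on refuter
g44-4's flag — with F only C¹ the pressure is merely C⁰ along a smooth solution and the
gradient/divergence clauses of IsHardSphereEulerSolution are junk): if 0 < η₀, F is C² on (−η₀,η₀)
and agrees with hsExcessFreeEnergy on [0,η₀), then for every σ > 0 and every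
IsHardSphereEulerSolution σ T ρ u θ with ρσ³ < η₀ on [0,T)×𝕋³, ∫−ρ_t(3/2 log θ_t − log ρ_t −
hsExcessFreeEnergy(ρ_tσ³))dx is constant in t ∈ [0,T). Proof: on (0,η₀) deriv hsExcessFreeEnergy =
F′, so p = ρθ(1 + ρσ³F′(ρσ³)) and the Gibbs relation θds = de + p d(1/ρ) (e = 3θ/2) holds; the PDEs
give ∂_t(ρs) + div(ρsu) = 0; integrate over 𝕋³ (Torus.integral_divergence_eq_zero), differentiate
under the integral, vanishing timeDerivWithin on Ico 0 T. [difficulty: M] [Dafermos2005, Spohn1991]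
#9 MassTransport (support) — EXACT MASS TRANSPORT (pathwise continuity equation, provable now from
the HardSphereFlow trajectory axioms): for every σ, N, flow Φ, z in the good set, smooth χ and t ≥
0, D_N(Φ_t z)(χ) − D_N(Φ_0 z)(χ) = ∫_0^t Σ_i M_N(Φ_τ z)(∂_iχ)_i dτ — positions are continuous,
piecewise affine between the locally finite collision times, so τ ↦ χ(x_k(τ)) is Lipschitz with
derivative ∇χ(x_k)·v_k(τ) off collisions; FTC. Feeds the mass equation (density part of L) to the
prover of ModulatedEntropyStability. [difficulty: M] [GST2013, Alexander1975, Spohn1991] #9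
LlnImpliesRelEntropy (support) — HUB FACT (card (iii)): THE CONJUNCT'S CONCLUSION IMPLIES YAU'S
RELATIVE-ENTROPY FORM. For continuous positive profiles ∃η₀, σ₀ > 0 such that for σ < σ₀, every
classical solution on [0,T) with packing ρσ³ < η₀ and every flow family with local-Gibbs fields
converging at t = 0: if the fields ALSO converge at t < T, then for some continuous activity profile
a > 0 the matched local Gibbs laws λ_t^N = localGibbsLaw σ a (u t) (θ t) N (Φ N) are probability
measures and klDiv(lawAt (Φ N) (LG_N) t ‖ λ_t^N)/(N+1) → 0 (Yau1991 form; converse of the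
relative-entropy routes' assembly, so RelEntropyVanishing stmt-0766 ⇔ conjunct pre-shock). Sketch:
H(f_t|ψ_a)/N′ = E_{f_0}Λ₀(U) − E_{f_t}Λ_a(U) + N′⁻¹log(Z_a/Z₀) exactly (flow invariance, linear
tilts); LLN at 0 and t dominated by the conserved energy; N′⁻¹log Z → Λ(P) − I(P) (dilute Laplace);
a reproduces ρ_t at θ_t; S(P_t) = S(P_0) by EulerIsentropic. [difficulty: L] [Yau1991,
OllaVaradhanYau1993, Spohn1991, LebowitzPenrose1964, Ruelle1969] #9 HsEosLowDensity (support,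
PROVED) — (shared stmt-AtomisticToContinuum-0768) the hard-sphere excess free energy is
real-analytic on a neighbourhood of [0,η₀) with F(0) = 0, F′(0) = 2π/3 and the canonical
thermodynamic limit exists there (Ruelle1969 Thm 3.4.4, 4.3.2; LebowitzPenrose1964); antecedent 1 of
ModulatedEntropyStability (C² EOS, hyperbolicity, strict convexity band), discharged in `closes` by
`HsEosLowDensity_holds`. [difficulty: L] [Ruelle1969, LebowitzPenrose1964] #9 HsEntropyConvex
(support, PROVED) — (shared stmt-AtomisticToContinuum-9906; lemma for ModulatedEntropyStability —
coercivity and relative-flux bounds) given the EOS fact, ∃η₀ > 0 ∀σ > 0: U = (ρ,m,E) ↦ −ρ(3/2 log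
θ(U) − log ρ − f_ex(ρσ³)) is strictly convex on {ρ > 0, ρσ³ < η₀, |m|² < 2ρE} ((ηZ)′ > 0 near 0 +
perspective argument). [difficulty: M] [Dafermos1979, BrezinaFeireisl2018, Ruelle1969] DROPPED
2026-08-16: DiluteSelfConsistency (shared stmt-AtomisticToContinuum-3091, stays on
AnnealedZeroHorizon / BoxDissipativeWeakStrong) — it only removed the packing guard of the old
unguarded abbrev; the re-typed Statement carries the guard `ρσ³ < η₀ on [0,T)` as a hypothesis.

TWO-LAYER PLAN. Foreseen glued splits (none filed; k ≤ 3, depth 1): MacroSecondLaw ⇐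
GibbsProfileLdUpperBound → DiluteLaplaceLowerBound → FlooredEntropyContinuity; MomentumFluxLocality
⇐ KineticStressIsotropy → CollisionalVirial; EnergyFluxLocality ⇐ TimeIntegratedCubicTail →
HeatFluxVanishes; ModulatedEntropyStability ⇐ RelEntropyCoercivity → FixedMollifierGronwall →
MollifierRemoval (isentropy = support EulerIsentropic).

KILL CRITERIA. ¬MomentumFluxLocality or ¬EnergyFluxLocality for some smooth pre-shock datum
(time-averaged collisional transfer ≠ ρθ(Z−1)𝟙 on good events, or a non-vanishing Euler-order heat
flux) closes the route `refuted:<Decl>` and, both being necessary for the conjunct at every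
resolution, all but refutes the conjunct — file ¬HydrodynamicLimitFor then. ¬MacroSecondLaw can only
come from formalisation conventions (else it contradicts Liouville + LDP): repair by restating
(clamped entropy / stronger floor), do not close. ¬NoConcentration with the flux cruxes intact (a
genuine pre-shock coarse hot/cold spot) forces the pivot to the annealed bookkeeping of
AnnealedZeroHorizon or to a temperature-clamped entropy (new crux 'local second law' — a different
route). ModulatedEntropyStability is theorem-shaped: failure = a quantifier mismatch, repaired by
`--restate`. DiluteSelfConsistency / its negation DenseExcursion (implosion tracking) no longer bear
on this route or on the conjunct: since the re-type hydro2 the Statement IS the guarded conjunct.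
RelEntropyVanishing (stmt-0766) or AnnealedWeakStrong + MeanFluxClosure proved elsewhere moots the
positive half, not the hub facts MacroSecondLaw / LlnImpliesRelEntropy.

NOT DECOMPOSED YET. (a) The static inputs of MacroSecondLaw (Gibbs LD upper bound at all densities,
dilute Laplace lower bound, floored continuity) ride as --supports lemmas until a tenure split. (b)
The constants of ModulatedEntropyStability (coercivity and relative-flux bounds on the good box,
joint measurability of (τ,z) ↦ Φ_τ z on the good set, the Fubini bad-time-set argument, mollifier
removal = the old Assembly of EntropyBookkeeping) are layer-2 children; its isentropy step is the
filed support EulerIsentropic. (c) ColemanNollEos (card (v): any Galilean-covariant continuous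
zeroth-order closure compatible with MacroSecondLaw has p = hsPressure, q = 0) is filed only if a
prover weakens the flux cruxes to 'some covariant closure'. (d) Dense pre-shock excursions of
strongly compressive solutions are outside the re-typed Statement (packing guard) — nothing to
attack. (e) No definition requests (all notions are inlined lets).

CHEAPEST FALSIFIER. (1) MacroSecondLaw at Ψ = id and at Ψ = flipVel (both Liouville- and
energy-preserving): ∫η_σ(P₁⋆φ) ≤ ∫η_σ(P₁) by Jensen, and the LD exponent sup_P min(g(P), g(P) − S(P)
+ S(Q)) − g(P₁) = −κ < 0 for a two-temperature profile — re-derive with the canonical energy-shell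
bookkeeping and the junk conventions at the floor (by hand: with exact energy conservation the
exponent is β-independent). (2) Flux cruxes at global equilibrium (a₀, θ₀ const, u₀ = 0) and for a
uniform translation: increments and closure agree in expectation exactly (stationarity + virial
theorem), fluctuations O(N^{-1/2}); at t = 0 the defect is 0 and the typed event empty — a mismatch
there kills the typing, not the physics. (3) Degenerate-instance sweep (negatives index): φ ≡ 1
needs r > 1/2 (never forced, r existential); c > 1 keeps the NoConcentration margins positive (∫ρ =
1 pins inf ρ ≤ 1 ≤ sup ρ); every hsPressure evaluation sits below the cap Λσ³ ≤ η₀ on the good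
event. (4) Dafermos' computation on 𝕋³ uses only d/dt∫η ≤ 0 (Dafermos1979 §4; re-derived at card
triage).

NUMBERS. Fixed reduced density: (N+1)ε_N³ = σ³, ≍ (N+1)^{1/3} collisions per particle per unit time,
Kn_N = ε_N/σ³. Z(η) = 1 + (2π/3)η + O(η²); hard-sphere freezing at packing fraction ≈ 0.494 (ρd³ ≈
0.94) bounds any fluid band from above; the virial series converges below the Lebowitz–Penrose
radius (≈ 0.03 in packing fraction, rigorous). Items at open: 12 (5 cruxes, 6 supports, 1 assembly);
after the 2026-08-16 repairs: 11 (5 cruxes, 5 supports, 1 assembly); hypotheses of `closes`: 5 (the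
cruxes).

DEFINITION REQUESTS. None: every notion is inlined over the hard-sphere prelude (Config,
HardSphereFlow, liouville, configEnergy, localGibbsLaw, empirical*Field, hsPressure,
hsExcessFreeEnergy, TendstoHydroFieldsAt, Torus calculus, klDiv).

CONE AUDIT + REPAIR. needs-fact: NONE (gens 1–3, 2026-08-15/16). Gate: `closes` native-OK; 0
unproved deps among the 63 project constants of the items' cone; staffable. The 6 unproved named
facts of the MODULE import cone are open-problem statements inherited from the mandatory import
Summits.AtomisticToContinuum.Statement: the sibling conjuncts FouriersLaw, Crystallization,
BoseEinsteinCondensation, the unguarded Literature HydrodynamicLimit (HardSphereEuler.lean) and the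
@[conjecture] HydrodynamicLimitDim / HydroLimitInBandDim (HardSphereEulerDim.lean, imported by the
re-typed sub Statement) — none is a hypothesis of an item or of `closes` (the Statement is its
CONCLUSION). The one import beyond the template, Theorems.ImplosionDichotomyHsEosLowDensity, is the
proved witness of HsEosLowDensity; 0 imports droppable; no crux rests on an unproved fact. Gen 1
(2026-08-15): lost edge to DiluteSelfConsistency re-attached. Gen 2 (re-type hydro2 p126922,
2026-08-16): `closes` := pure application of ModulatedEntropyStability, DiluteSelfConsistency
dropped, EulerIsentropic / antecedent 6 re-typed C¹-F → C²-F (refuter g44-4 flag). Gen 3 (gate lint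
glue.non-crux-hypothesis = EulerIsentropic, 2026-08-16): ModulatedEntropyStability restated WITHOUT
the isentropy antecedent (the step is proved inside; EulerIsentropic kept as its support lemma),
Assembly restated to the 5-antecedent shape, `closes` := `hStab HsEosLowDensity_holds hSL hM hE hNC`
with hypotheses = the 5 cruxes only (Sketch.lean rc 0, axioms standard); 0 imports dropped, 2 items
restated, 0 added.

Novelty: Searches (2026-08-15, this planner): `lit frontier AtomisticToContinuum --since 2022` (30 rows;
nearest: arXiv:2310.13338 heat equation
from deterministic dynamics — diffusive, other conjunct; nothing on entropy bookkeeping for hard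
spheres); `lit bridges AtomisticToContinuum
--cross any` (30 rows, convex-integration / Ising surveys, none relevant); `lit search --source
crossref "Georgii large deviations equivalence
of ensembles …"` (→ Georgii1994 doi:10.1007/bf01199021, Georgii1995 doi:10.1007/bf02179874); `lit
search --source arxiv "modulated energy
Newton second law Euler derivation particles"` (2: arXiv:2104.11723 Rosenzweig incompressible Euler
from Newton, arXiv:2408.14642 lake
equation — mean-field, monokinetic); `lit search --source arxiv "relative entropy method
compressible Euler particle system modulated entropy
weak-strong"` (0); `lit galaxy search "modulated entropy" --star pdf` (3: arXiv:1502.07890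
Vlasov→incompressible Euler, BGSS ICM 2022 survey
(dilute hard spheres, cumulant/modulated exponential moments), Allemand thesis); galaxy --star all
on "H-theorem from Liouville" /
"macroscopic second law large deviations" (0); `lit search --hybrid` local (vector leg only:
Gaspard2022, Ellis2006 LD textbooks). Inherited
from the card + gen-1 route (logged in EntropyBookkeeping.lean): Sasa2014, GoldsteinLebowitz2004,
Gaspard2022 (3.40)–(3.47), Spohn1991 (7.16),
RoeckMaesNetocny2006, HanKwanIacobelli2021, Serfaty2020, Bresch–Jabin–Wang doi:10.5802/slsedp.135,
Feireisl–J  [refs: 10.1007/bf01199021, 10.1007/bf02179874, 10.5802/slsedp.135, 10.1007/s00021-011-0091-9., 2310.13338, 2104.11723, 2408.14642, 1502.07890, doi:10.1007/bf01199021, doi:10.1007/bf02179874, doi:10.5802/slsedp.135, doi:10.1007/s00021-011-0091-9., Georgii1994, Georgii1995, Gaspard2022, Sasa2014, GoldsteinLebowitz2004, Spohn1991, RoeckMaesNetocny2006, HanKwanIacobelli2021, Serfaty2020, Dafermos1979, Brezin]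

Barriers (technique_class: modulated-entropy weak-strong large-deviations liouville): - technique_class: modulated-entropy weak-strong large-deviations liouville
- Literature.Barriers.AtomisticToContinuum.BoltzmannHypothesisBarrier (and
BoltzmannHypothesisBarrierNarrow): applies to MomentumFluxLocality / EnergyFluxLocality only — they
ARE the local-equilibrium closure of the currents, in typed mollified form on good events; it does
not apply to MacroSecondLaw, NoConcentration or ModulatedEntropyStability (no one-block replacement,
no classification of stationary states, no transported reference state). The line does not claim to
evade it for the flux cruxes; the bet is that once admissibility, EOS identification and entropy
bookkeeping are free and a-priori control is split off, the residual closure is attackable by time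
averaging / virialisation over the ≍ N^{1/3} collisions per particle per unit time, which needs no
GibbsErgodicity-type theorem; the barrier's free-gas kernel (no collisions) fails flux locality
exactly, consistently.
- Literature.Barriers.AtomisticToContinuum.HighMomentumCutoffBarrier (and
HighMomentumCutoffBarrierNarrow): applies to EnergyFluxLocality (cubic moment inside its proof) and
to NoConcentration (coarse energy bound); evaded in FORM — every statement and the Gronwall contain
only bounded empirical quantities (increments of the conserved energy field, fluxes of coarse fields
inside the good box), never E_{f_t} of an unbounded current, and MacroSecondLaw needs no moment
bound (Gaussian tilt of the invariant law); NOT evaded in substa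

History (route lifecycle, newest last):
- 2026-08-16T23:23:00Z · rev 3: restated Assembly (stmt-AtomisticToContinuum-13375) — route-repair (retype hydro2) cleanup: Assembly restated to the 7-antecedent shape of closes; DiluteSelfConsistency (stmt-3091) dropped from this route — load-be (planner-rrepair-AtomisticToContinuum-Invariant-51590997-0)
- 2026-08-16T23:23:00Z · rev 3: dropped DiluteSelfConsistency — route-repair (retype hydro2) cleanup: Assembly restated to the 7-antecedent shape of closes; DiluteSelfConsistency (stmt-3091) dropped from this route — load-be (planner-rrepair-AtomisticToContinuum-Invariant-51590997-0)
- 2026-08-16T23:23:50Z · rev 4: restated ModulatedEntropyStability (stmt-AtomisticToContinuum-13371) — typing repair (refuter g44-4 / grounder g27-12 flag of 2026-08-15, released to the planner): antecedent 6 of ModulatedEntropyStability (= EulerIsentropic inline (planner-rrepair-AtomisticToContinuum-Invariant-51590997-0)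
- 2026-08-16T23:28:59Z · rev 5: restated EulerIsentropic (stmt-AtomisticToContinuum-13372) — typing repair (refuter g44-4 flag of 2026-08-15, item released to the planner unstamped): EulerIsentropic re-typed `ContDiffOn ℝ 1 F` → `ContDiffOn ℝ 2 F`, verb (planner-rrepair-AtomisticToContinuum-Invariant-51590997-0)
- 2026-08-16T23:42:13Z · rev 7: restated ModulatedEntropyStability (stmt-AtomisticToContinuum-17614), Assembly (stmt-AtomisticToContinuum-17596) — route-repair gen 3 (glue.non-crux-hypothesis = EulerIsentropic): closes made CRUX-ONLY. ModulatedEntropyStability (crux r6, unvetted since rev 4) restated WITHO (planner-rbadge-AtomisticToContinuum-InvariantG-86709c6d-0)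
- 2026-08-22T17:47:04Z · DORMANT — reconciler: no traction for 5.5 d (last activity item-evidence-added at 2026-08-17T04:20:05Z); parked, not closed — `ledger route dormant route-AtomisticToConti (operator:999:2215700)

sub-problem: HydrodynamicLimit · status: dormant · opened planner-plancard-AtomisticToContinuum-Hydrody-237fa1f8-g2-0 2026-08-15T19:01:24Z · rev 7 · ledger route-AtomisticToContinuum-InvariantGibbsBookkeeping
GENERATED by the gate from the ledger (D-0016/17). Provers cite these decls: `theorem foo : Summit.AtomisticToContinuum.HydrodynamicLimit.Theses.InvariantGibbsBookkeeping.<Decl> := …` in Summits/AtomisticToContinuum/HydrodynamicLimit/Theorems/<Name>.lean.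
-/

namespace Summit.AtomisticToContinuum.HydrodynamicLimit.Theses.InvariantGibbsBookkeeping

open scoped BigOperators Topology Manifold Classical MeasureTheory ProbabilityTheory Matrix InnerProductSpace ComplexConjugate ContinuousMap
open Filter Set Function TopologicalSpace MeasureTheory

attribute [summit_statement] _root_.HydrodynamicLimit

/-- item stmt-AtomisticToContinuum-13367 · crux · rank 2 · open · by planner
why it might fail: Arbitrary Ψ_N are adversarial: any residual LD-irregularity of the floored coarse-entropy functional (sub-extensive cold clusters above the floor, Bochner/log junk: log 0 = 0, ∫ = 0 if non-integrable, f_ex junk beyond close packing) lets a Liouville rearrangement beat the profile-level bound.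
sources: Georgii1994, Georgii1995, GeorgiiZessin1993, RoeckMaesNetocny2006, Sasa2014, GoldsteinLebowitz2004
[crux] MACROSCOPIC SECOND LAW WITHOUT DYNAMICS (card (i)–(ii)). For continuous positive profiles
there is σ₀ such that for σ < σ₀, every continuous positive triple (ρ₁,u₁,θ₁) that is the time-0 LLN
limit of the local-Gibbs fields, EVERY sequence of measurable maps Ψ_N of (N+1)-sphere phase space
preserving the Liouville measure of the hard-sphere domain and the kinetic energy a.e., every
continuous kernel φ ≥ 0 with ∫φ = 1, every floor λ > 0 and κ > 0: P_LG([∀x, ρ_φ(Ψ_N z)(x) ≥ λ] ∧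
∫η_σ(U(Ψ_N z)⋆φ)dx > ∫η_σ(ρ₁,ρ₁u₁,E(ρ₁,u₁,θ₁))dx + κ) → 0, where η_σ(ρ,m,E) = −ρ(3/2 log θ − log ρ −
hsExcessFreeEnergy(ρσ³)), θ = ⅔(E/ρ − |m|²/2ρ²), evaluated on the φ-mollified empirical fields
(inlined lets ρK mK eK). Mechanism: dLG/dG_β = e^{N'Λ(U_N)}/ratio, Λ linear in the empirical fields,
G_β invariant under Ψ_N; LD upper bound for the mollified empirical field under the canonical
hard-sphere state at ALL densities, Laplace lower bound N'⁻¹log(Z_LG/Z_G) at the dilute profile,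
Jensen (η_σ convex), exact energy conservation (the exponent is then β-independent); the density
floor makes the coarse-entropy functional continuous on finite-rate profiles (it removes the
isolated-cold-pair irregularity). -/
@[route_item "route-AtomisticToContinuum-InvariantGibbsBookkeeping", crux]
def MacroSecondLaw : Prop :=
  let η : ℝ → ℝ → EuclideanSpace ℝ (Fin 3) → ℝ → ℝ := fun σ' ρ' m e => -(ρ' * (3 / 2 * Real.log (2 / 3 * (e / ρ' - ‖m‖ ^ 2 / (2 * ρ' ^ 2))) - Real.log ρ' - Literature.MathematicalPhysics.KineticTheory.hsExcessFreeEnergy (ρ' * σ' ^ 3))); let ρK : {n : ℕ} → (UnitAddTorus (Fin 3) → ℝ) → Literature.Analysis.FluidPDE.Config n (Fin 3) (UnitAddTorus (Fin 3)) → UnitAddTorus (Fin 3) → ℝ := fun φ z x => Literature.MathematicalPhysics.KineticTheory.empiricalDensityField z (fun y => φ (x - y)); let mK : {n : ℕ} → (UnitAddTorus (Fin 3) → ℝ) → Literature.Analysis.FluidPDE.Config n (Fin 3) (UnitAddTorus (Fin 3)) → UnitAddTorus (Fin 3) → EuclideanSpace ℝ (Fin 3) := fun φ z x => Literature.MathematicalPhysics.KineticTheory.empiricalMomentumField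 z (fun y => φ (x - y)); let eK : {n : ℕ} → (UnitAddTorus (Fin 3) → ℝ) → Literature.Analysis.FluidPDE.Config n (Fin 3) (UnitAddTorus (Fin 3)) → UnitAddTorus (Fin 3) → ℝ := fun φ z x => Literature.MathematicalPhysics.KineticTheory.empiricalEnergyField z (fun y => φ (x - y)); ∀ (a₀ θ₀ : UnitAddTorus (Fin 3) → ℝ) (u₀ : UnitAddTorus (Fin 3) → EuclideanSpace ℝ (Fin 3)), Continuous a₀ → Continuous θ₀ → Continuous u₀ → (∀ x, 0 < a₀ x) → (∀ x, 0 < θ₀ x) → ∃ σ₀ : ℝ, 0 < σ₀ ∧ ∀ σ : ℝ, 0 < σ → σ < σ₀ → ∀ (ρ₁ θ₁ : UnitAddTorus (Fin 3) → ℝ) (u₁ : UnitAddTorus (Fin 3) → EuclideanSpace ℝ (Fin 3)), Continuous ρ₁ → Continuous θ₁ → Continuous u₁ → (∀ x, 0 < ρ₁ x) → (∀ x, 0 < θ₁ x) → ∀ Φ : (N : ℕ) → Literature.Analysis.FluidPDE.HardSphereFlow (Literature.Analysis.FluidPDE.Torus.geometry (Fin 3)) (Literature.MathematicalPhysics.KineticTheory.hsDiameter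 σ N) (N + 1), Literature.MathematicalPhysics.KineticTheory.TendstoHydroFieldsAt (fun N => Literature.MathematicalPhysics.KineticTheory.localGibbsLaw σ a₀ u₀ θ₀ N (Φ N)) Φ (fun _ => ρ₁) (fun _ => u₁) (fun _ => θ₁) 0 → ∀ Ψ : (N : ℕ) → Literature.Analysis.FluidPDE.Config (N + 1) (Fin 3) (UnitAddTorus (Fin 3)) → Literature.Analysis.FluidPDE.Config (N + 1) (Fin 3) (UnitAddTorus (Fin 3)), (∀ N, Measurable (Ψ N)) → (∀ N, MeasureTheory.MeasurePreserving (Ψ N) (Literature.Analysis.FluidPDE.liouville (Literature.Analysis.FluidPDE.Torus.geometry (Fin 3)) (N + 1) (Literature.MathematicalPhysics.KineticTheory.hsDiameter σ N)) (Literature.Analysis.FluidPDE.liouville (Literature.Analysis.FluidPDE.Torus.geometry (Fin 3)) (N + 1) (Literature.MathematicalPhysics.KineticTheory.hsDiameter σ N))) → (∀ N, ∀ᵐ z ∂(Literature.Analysis.FluidPDE.liouville (Literature.Analysis.FluidPDE.Torus.geometry (Fin 3)) (N + 1) (Literature.MathematicalPhysics.KineticTheory.hsDiameter σ N)), Literature.Analysis.FluidPDE.configEnergy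 (Ψ N z) = Literature.Analysis.FluidPDE.configEnergy z) → ∀ φ : UnitAddTorus (Fin 3) → ℝ, Continuous φ → (∀ y, 0 ≤ φ y) → ∫ y, φ y = 1 → ∀ lam : ℝ, 0 < lam → ∀ κ : ℝ, 0 < κ → Filter.Tendsto (fun N : ℕ => Literature.MathematicalPhysics.KineticTheory.localGibbsLaw σ a₀ u₀ θ₀ N (Φ N) {z | (∀ x, lam ≤ ρK φ (Ψ N z) x) ∧ (∫ x, η σ (ρ₁ x) (ρ₁ x • u₁ x) (Literature.MathematicalPhysics.KineticTheory.totalEnergyDensity (ρ₁ x) (u₁ x) (θ₁ x))) + κ < ∫ x, η σ (ρK φ (Ψ N z) x) (mK φ (Ψ N z) x) (eK φ (Ψ N z) x)}) Filter.atTop (nhds 0)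

/-- item stmt-AtomisticToContinuum-13368 · crux · rank 3 · open · by planner
why it might fail: It IS local equilibrium of the momentum current at fixed σ > 0: persistent mesoscopic position–velocity (ring/recollision) correlations before T could shift the time-averaged collisional transfer off ρθ(Z−1)𝟙; no mixing theorem for deterministic spheres exists (Spohn1991 I.3 p. 44).
sources: Spohn1991, OllaVaradhanYau1993, KipnisLandim1999, NachtergaeleYau2003, Literature.Barriers.AtomisticToContinuum.BoltzmannHypothesisBarrierNarrow
[crux] MOMENTUM-FLUX LOCALITY ON GOOD EVENTS, PRE-SHOCK (card residual crux R; typed,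
Young-measure-free). There is a packing cap η₀ > 0 such that for continuous positive profiles, σ <
σ₀(profiles), every classical hs-Euler solution on [0,T) whose t = 0 fields are the LLN limit of the
local-Gibbs fields (the solution is only the CLOCK: pre-shock), every t < T, smooth χ, box
parameters λ > 0, Λ with Λσ³ ≤ η₀, M, and κ > 0 there is r > 0 such that for every continuous kernel
φ ≥ 0, ∫φ = 1, supported in the sup-ball B_r(0): P_LG( GOOD ∧ ‖M_N(Φ_t z)(χ) − M_N(Φ_0 z)(χ) −
∫_0^t∫_𝕋³[(m_φ·∇χ)m_φ/ρ_φ + hsPressure σ ρ_φ θ_φ ∇χ](Φ_τ z, x)dx dτ‖ > κ ) → 0, where GOOD = [∀τ ∈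
[0,t] ∀x: λ ≤ ρ_φ ≤ Λ, e_φ ≤ M, θ_φ ≥ λ] for the φ-coarse fields (ρ_φ,m_φ,e_φ) along the trajectory
and θ_φ = ⅔(e_φ/ρ_φ − |m_φ|²/2ρ_φ²). Content: the time-integrated kinetic stress → ρ_φu_φ⊗u_φ +
ρ_φθ_φ𝟙 and collisional transfer → ρθ(Z(ρσ³) − 1)𝟙 (virial theorem at contact) at every positive
macroscopic resolution, GIVEN a-priori bounds; time averaging over the ≍ N^{1/3} collisions per
particle is the lever. Necessary for the conjunct, so a refutation bears on the conjunct itself.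
[difficulty: open-problem] -/
@[route_item "route-AtomisticToContinuum-InvariantGibbsBookkeeping", crux]
def MomentumFluxLocality : Prop :=
  let ρK : {n : ℕ} → (UnitAddTorus (Fin 3) → ℝ) → Literature.Analysis.FluidPDE.Config n (Fin 3) (UnitAddTorus (Fin 3)) → UnitAddTorus (Fin 3) → ℝ := fun φ z x => Literature.MathematicalPhysics.KineticTheory.empiricalDensityField z (fun y => φ (x - y)); let mK : {n : ℕ} → (UnitAddTorus (Fin 3) → ℝ) → Literature.Analysis.FluidPDE.Config n (Fin 3) (UnitAddTorus (Fin 3)) → UnitAddTorus (Fin 3) → EuclideanSpace ℝ (Fin 3) := fun φ z x => Literature.MathematicalPhysics.KineticTheory.empiricalMomentumField z (fun y => φ (x - y)); let eK : {n : ℕ} → (UnitAddTorus (Fin 3) → ℝ) → Literature.Analysis.FluidPDE.Config n (Fin 3) (UnitAddTorus (Fin 3)) → UnitAddTorus (Fin 3) → ℝ := fun φ z x => Literature.MathematicalPhysics.KineticTheory.empiricalEnergyField z (fun y => φ (x - y)); let θK : ℝ → EuclideanSpace ℝ (Fin 3) → ℝ → ℝ := fun ρ' m e => 2 / 3 * (e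 / ρ' - ‖m‖ ^ 2 / (2 * ρ' ^ 2)); let good : {n : ℕ} → (UnitAddTorus (Fin 3) → ℝ) → ℝ → ℝ → ℝ → (ℝ → Literature.Analysis.FluidPDE.Config n (Fin 3) (UnitAddTorus (Fin 3))) → ℝ → Prop := fun φ lam Λ M γ t => ∀ τ ∈ Set.Icc 0 t, ∀ x, lam ≤ ρK φ (γ τ) x ∧ ρK φ (γ τ) x ≤ Λ ∧ eK φ (γ τ) x ≤ M ∧ lam ≤ θK (ρK φ (γ τ) x) (mK φ (γ τ) x) (eK φ (γ τ) x); let momFlux : ℝ → ℝ → EuclideanSpace ℝ (Fin 3) → ℝ → EuclideanSpace ℝ (Fin 3) → EuclideanSpace ℝ (Fin 3) := fun σ' ρ' m e g => (inner ℝ m g / ρ') • m + Literature.MathematicalPhysics.KineticTheory.hsPressure σ' ρ' (θK ρ' m e) • g; ∃ η₀ : ℝ, 0 < η₀ ∧ ∀ (a₀ θ₀ : UnitAddTorus (Fin 3) → ℝ) (u₀ : UnitAddTorus (Fin 3) → EuclideanSpace ℝ (Fin 3)), Continuous a₀ → Continuous θ₀ → Continuous u₀ → (∀ x, 0 < a₀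 x) → (∀ x, 0 < θ₀ x) → ∃ σ₀ : ℝ, 0 < σ₀ ∧ ∀ σ : ℝ, 0 < σ → σ < σ₀ → ∀ (T : ℝ) (ρ θ : ℝ → UnitAddTorus (Fin 3) → ℝ) (u : ℝ → UnitAddTorus (Fin 3) → EuclideanSpace ℝ (Fin 3)), Literature.MathematicalPhysics.KineticTheory.IsHardSphereEulerSolution σ T ρ u θ → ∀ Φ : (N : ℕ) → Literature.Analysis.FluidPDE.HardSphereFlow (Literature.Analysis.FluidPDE.Torus.geometry (Fin 3)) (Literature.MathematicalPhysics.KineticTheory.hsDiameter σ N) (N + 1), Literature.MathematicalPhysics.KineticTheory.TendstoHydroFieldsAt (fun N => Literature.MathematicalPhysics.KineticTheory.localGibbsLaw σ a₀ u₀ θ₀ N (Φ N)) Φ ρ u θ 0 → ∀ t ∈ Set.Ico 0 T, ∀ χ : UnitAddTorus (Fin 3) → ℝ, Literature.Analysis.FunctionSpaces.Torus.IsSmooth χ → ∀ lam Λ M : ℝ, 0 < lam → Λ * σ ^ 3 ≤ η₀ → ∀ κ : ℝ, 0 < κ → ∃ r : ℝ, 0 < r ∧ ∀ φ : UnitAddTorus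 (Fin 3) → ℝ, Continuous φ → (∀ y, 0 ≤ φ y) → ∫ y, φ y = 1 → (∀ y, r ≤ ‖y‖ → φ y = 0) → Filter.Tendsto (fun N : ℕ => Literature.MathematicalPhysics.KineticTheory.localGibbsLaw σ a₀ u₀ θ₀ N (Φ N) {z | good φ lam Λ M (fun τ => (Φ N).flow τ z) t ∧ κ < ‖Literature.MathematicalPhysics.KineticTheory.empiricalMomentumField ((Φ N).flow t z) χ - Literature.MathematicalPhysics.KineticTheory.empiricalMomentumField ((Φ N).flow 0 z) χ - ∫ τ in Set.Ioc 0 t, ∫ x, momFlux σ (ρK φ ((Φ N).flow τ z) x) (mK φ ((Φ N).flow τ z) x) (eK φ ((Φ N).flow τ z) x) (Literature.Analysis.FunctionSpaces.Torus.gradient χ x)‖}) Filter.atTop (nhds 0)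

/-- item stmt-AtomisticToContinuum-13369 · crux · rank 4 · open · by planner
why it might fail: Needs control of the cubic velocity moment of the microscopic energy current along the evolved law (HighMomentumCutoff barrier; OVY93 §1 modified the kinetic energy; Nachtergaele–Yau Assumption II.1 'no proof') AND a vanishing Euler-order heat flux at fixed σ.
sources: OllaVaradhanYau1993, NachtergaeleYau2003, Spohn1991, Literature.Barriers.AtomisticToContinuum.HighMomentumCutoffBarrier
[crux] ENERGY-FLUX LOCALITY ON GOOD EVENTS, PRE-SHOCK (the HighMomentumCutoff-carrying half of the
closure). Same frame, quantifiers and GOOD event as MomentumFluxLocality, for the empirical ENERGY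
field E_N = empiricalEnergyField: P_LG( GOOD ∧ |E_N(Φ_t z)(χ) − E_N(Φ_0 z)(χ) − ∫_0^t∫_𝕋³ (e_φ +
hsPressure σ ρ_φ θ_φ)(m_φ·∇χ)/ρ_φ (Φ_τ z, x)dx dτ| > κ ) → 0: the time-integrated microscopic energy
current (kinetic part (N+1)⁻¹Σ_i(v_i·∇χ)|v_i|²/2, a CUBIC velocity moment, plus collisional
transfer) is the hs-Euler enthalpy flux (E+p)u of the coarse state with ZERO Euler-order heat flux.
Only bounded quantities appear (increments of the conserved energy field, fluxes inside the good
box); the cubic tail lives inside the proof (OVY93 modified the kinetic energy to avoid it).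
Necessary for the conjunct. [difficulty: open-problem] -/
@[route_item "route-AtomisticToContinuum-InvariantGibbsBookkeeping", crux]
def EnergyFluxLocality : Prop :=
  let ρK : {n : ℕ} → (UnitAddTorus (Fin 3) → ℝ) → Literature.Analysis.FluidPDE.Config n (Fin 3) (UnitAddTorus (Fin 3)) → UnitAddTorus (Fin 3) → ℝ := fun φ z x => Literature.MathematicalPhysics.KineticTheory.empiricalDensityField z (fun y => φ (x - y)); let mK : {n : ℕ} → (UnitAddTorus (Fin 3) → ℝ) → Literature.Analysis.FluidPDE.Config n (Fin 3) (UnitAddTorus (Fin 3)) → UnitAddTorus (Fin 3) → EuclideanSpace ℝ (Fin 3) := fun φ z x => Literature.MathematicalPhysics.KineticTheory.empiricalMomentumField z (fun y => φ (x - y)); let eK : {n : ℕ} → (UnitAddTorus (Fin 3) → ℝ) → Literature.Analysis.FluidPDE.Config n (Fin 3) (UnitAddTorus (Fin 3)) → UnitAddTorus (Fin 3) → ℝ := fun φ z x => Literature.MathematicalPhysics.KineticTheory.empiricalEnergyField z (fun y => φ (x - y)); let θK : ℝ → EuclideanSpace ℝ (Fin 3) → ℝ → ℝ := fun ρ' m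 e => 2 / 3 * (e / ρ' - ‖m‖ ^ 2 / (2 * ρ' ^ 2)); let good : {n : ℕ} → (UnitAddTorus (Fin 3) → ℝ) → ℝ → ℝ → ℝ → (ℝ → Literature.Analysis.FluidPDE.Config n (Fin 3) (UnitAddTorus (Fin 3))) → ℝ → Prop := fun φ lam Λ M γ t => ∀ τ ∈ Set.Icc 0 t, ∀ x, lam ≤ ρK φ (γ τ) x ∧ ρK φ (γ τ) x ≤ Λ ∧ eK φ (γ τ) x ≤ M ∧ lam ≤ θK (ρK φ (γ τ) x) (mK φ (γ τ) x) (eK φ (γ τ) x); let enFlux : ℝ → ℝ → EuclideanSpace ℝ (Fin 3) → ℝ → EuclideanSpace ℝ (Fin 3) → ℝ := fun σ' ρ' m e g => (e + Literature.MathematicalPhysics.KineticTheory.hsPressure σ' ρ' (θK ρ' m e)) / ρ' * inner ℝ m g; ∃ η₀ : ℝ, 0 < η₀ ∧ ∀ (a₀ θ₀ : UnitAddTorus (Fin 3) → ℝ) (u₀ : UnitAddTorus (Fin 3) → EuclideanSpace ℝ (Fin 3)), Continuous a₀ → Continuous θ₀ → Continuous u₀ → (∀ x, 0 < a₀ x)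 → (∀ x, 0 < θ₀ x) → ∃ σ₀ : ℝ, 0 < σ₀ ∧ ∀ σ : ℝ, 0 < σ → σ < σ₀ → ∀ (T : ℝ) (ρ θ : ℝ → UnitAddTorus (Fin 3) → ℝ) (u : ℝ → UnitAddTorus (Fin 3) → EuclideanSpace ℝ (Fin 3)), Literature.MathematicalPhysics.KineticTheory.IsHardSphereEulerSolution σ T ρ u θ → ∀ Φ : (N : ℕ) → Literature.Analysis.FluidPDE.HardSphereFlow (Literature.Analysis.FluidPDE.Torus.geometry (Fin 3)) (Literature.MathematicalPhysics.KineticTheory.hsDiameter σ N) (N + 1), Literature.MathematicalPhysics.KineticTheory.TendstoHydroFieldsAt (fun N => Literature.MathematicalPhysics.KineticTheory.localGibbsLaw σ a₀ u₀ θ₀ N (Φ N)) Φ ρ u θ 0 → ∀ t ∈ Set.Ico 0 T, ∀ χ : UnitAddTorus (Fin 3) → ℝ, Literature.Analysis.FunctionSpaces.Torus.IsSmooth χ → ∀ lam Λ M : ℝ, 0 < lam → Λ * σ ^ 3 ≤ η₀ → ∀ κ : ℝ, 0 < κ → ∃ r : ℝ, 0 < r ∧ ∀ φ : UnitAddTorus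 (Fin 3) → ℝ, Continuous φ → (∀ y, 0 ≤ φ y) → ∫ y, φ y = 1 → (∀ y, r ≤ ‖y‖ → φ y = 0) → Filter.Tendsto (fun N : ℕ => Literature.MathematicalPhysics.KineticTheory.localGibbsLaw σ a₀ u₀ θ₀ N (Φ N) {z | good φ lam Λ M (fun τ => (Φ N).flow τ z) t ∧ κ < |Literature.MathematicalPhysics.KineticTheory.empiricalEnergyField ((Φ N).flow t z) χ - Literature.MathematicalPhysics.KineticTheory.empiricalEnergyField ((Φ N).flow 0 z) χ - ∫ τ in Set.Ioc 0 t, ∫ x, enFlux σ (ρK φ ((Φ N).flow τ z) x) (mK φ ((Φ N).flow τ z) x) (eK φ ((Φ N).flow τ z) x) (Literature.Analysis.FunctionSpaces.Torus.gradient χ x)|}) Filter.atTop (nhds 0)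

/-- item stmt-AtomisticToContinuum-13370 · crux · rank 5 · open · by planner
why it might fail: A macroscopic hot/cold spot, dilute fast stream or coarse vacuum before T costs only finite entropy (affordable far from equilibrium), so only dynamics excludes it; no a-priori maximum principle for coarse fields of deterministic spheres is known; τ-uniformity needs collision-rate control.
sources: Dafermos1979, OllaVaradhanYau1993, Spohn1991, Literature.Barriers.AtomisticToContinuum.HighMomentumCutoffBarrier
[crux] NO COARSE-GRAINED CONCENTRATION, VACUUM OR COLD SPOT BEFORE T (the a-priori control that
makes the good events of the flux cruxes typical and the Gronwall constants uniform). For profiles,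
σ < σ₀, a classical solution (ρ,u,θ) on [0,T) tied to the local-Gibbs data by the t = 0 LLN, t < T,
c > 1 and every continuous kernel φ ≥ 0 with ∫φ = 1: P_LG( ∃τ ∈ [0,t] ∃x: coarse density ρ_φ(Φ_τ
z)(x) below (inf ρ)/c, or above c·sup ρ, or coarse energy e_φ above c·sup E, or coarse temperature
θ_φ below (inf θ)/c — inf/sup over [0,t]×𝕋³, encoded as strict comparison with every value ρ(τ′,x′)
etc. ) → 0. Weaker than the conclusion at each fixed time (the LLN puts ρ_φ → ρ̄⋆φ ∈ [inf,sup] and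
θ(Ū⋆φ) ≥ inf θ̄ by concavity of ρθ) but UNIFORM in (τ,x); on its complement the coarse state stays
in a compact box where η_σ is bounded, uniformly convex, and relative fluxes (incl. the cubic
½ρ|u−ū|²(u−ū)) are ≤ Cη_σ(·|Ū). [difficulty: open-problem] -/
@[route_item "route-AtomisticToContinuum-InvariantGibbsBookkeeping", crux]
def NoConcentration : Prop :=
  let ρK : {n : ℕ} → (UnitAddTorus (Fin 3) → ℝ) → Literature.Analysis.FluidPDE.Config n (Fin 3) (UnitAddTorus (Fin 3)) → UnitAddTorus (Fin 3) → ℝ := fun φ z x => Literature.MathematicalPhysics.KineticTheory.empiricalDensityField z (fun y => φ (x - y)); let mK : {n : ℕ} → (UnitAddTorus (Fin 3) → ℝ) → Literature.Analysis.FluidPDE.Config n (Fin 3) (UnitAddTorus (Fin 3)) → UnitAddTorus (Fin 3) → EuclideanSpace ℝ (Fin 3) := fun φ z x => Literature.MathematicalPhysics.KineticTheory.empiricalMomentumField z (fun y => φ (x - y)); let eK : {n : ℕ} → (UnitAddTorus (Fin 3) → ℝ) → Literature.Analysis.FluidPDE.Config n (Fin 3) (UnitAddTorus (Fin 3)) →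 UnitAddTorus (Fin 3) → ℝ := fun φ z x => Literature.MathematicalPhysics.KineticTheory.empiricalEnergyField z (fun y => φ (x - y)); let θK : ℝ → EuclideanSpace ℝ (Fin 3) → ℝ → ℝ := fun ρ' m e => 2 / 3 * (e / ρ' - ‖m‖ ^ 2 / (2 * ρ' ^ 2)); ∀ (a₀ θ₀ : UnitAddTorus (Fin 3) → ℝ) (u₀ : UnitAddTorus (Fin 3) → EuclideanSpace ℝ (Fin 3)), Continuous a₀ → Continuous θ₀ → Continuous u₀ → (∀ x, 0 < a₀ x) → (∀ x, 0 < θ₀ x) → ∃ σ₀ : ℝ, 0 < σ₀ ∧ ∀ σ : ℝ, 0 < σ → σ < σ₀ → ∀ (T : ℝ) (ρ θ : ℝ → UnitAddTorus (Fin 3) → ℝ) (u : ℝ → UnitAddTorus (Fin 3) → EuclideanSpace ℝ (Fin 3)), Literature.MathematicalPhysics.KineticTheory.IsHardSphereEulerSolution σ T ρ u θ → ∀ Φ : (N : ℕ) → Literature.Analysis.FluidPDE.HardSphereFlow (Literature.Analysis.FluidPDE.Torus.geometry (Fin 3)) (Literature.MathematicalPhysics.KineticTheory.hsDiameter σ N)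 (N + 1), Literature.MathematicalPhysics.KineticTheory.TendstoHydroFieldsAt (fun N => Literature.MathematicalPhysics.KineticTheory.localGibbsLaw σ a₀ u₀ θ₀ N (Φ N)) Φ ρ u θ 0 → ∀ t ∈ Set.Ico 0 T, ∀ c : ℝ, 1 < c → ∀ φ : UnitAddTorus (Fin 3) → ℝ, Continuous φ → (∀ y, 0 ≤ φ y) → ∫ y, φ y = 1 → Filter.Tendsto (fun N : ℕ => Literature.MathematicalPhysics.KineticTheory.localGibbsLaw σ a₀ u₀ θ₀ N (Φ N) {z | ∃ τ ∈ Set.Icc 0 t, ∃ x : UnitAddTorus (Fin 3), (∀ τ' ∈ Set.Icc 0 t, ∀ x' : UnitAddTorus (Fin 3), c * ρK φ ((Φ N).flow τ z) x < ρ τ' x') ∨ (∀ τ' ∈ Set.Icc 0 t, ∀ x' : UnitAddTorus (Fin 3), c * ρ τ' x' < ρK φ ((Φ N).flow τ z) x) ∨ (∀ τ' ∈ Set.Icc 0 t, ∀ x' : UnitAddTorus (Fin 3), c * Literature.MathematicalPhysics.KineticTheory.totalEnergyDensity (ρ τ' x') (u τ' x') (θ τ' x') < eK φ ((Φ N).flow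 τ z) x) ∨ (∀ τ' ∈ Set.Icc 0 t, ∀ x' : UnitAddTorus (Fin 3), c * θK (ρK φ ((Φ N).flow τ z) x) (mK φ ((Φ N).flow τ z) x) (eK φ ((Φ N).flow τ z) x) < θ τ' x')}) Filter.atTop (nhds 0)

-- earlier ModulatedEntropyStability (stmt-AtomisticToContinuum-13371, replaced 2026-08-16T23:23:50Z -> stmt-AtomisticToContinuum-17614): retired by None — (∃ η₀ : ℝ, 0 < η₀ ∧ ∃ F : ℝ → ℝ, AnalyticOnNhd ℝ F (Set.Ioo (-η₀) η₀) ∧ Set.EqOn Literature.MathematicalPhysics.KineticTheory.hsExcessFreeEnergy F (Set.Ico 0 η₀) ∧ F 0 = 0 ∧ deriv F 0 = 2 * Real.pi / 3 ∧ ∀ η ∈ Set.Ico 0 η₀, Filter.Tendsto (fun N :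
-- earlier ModulatedEntropyStability (stmt-AtomisticToContinuum-17614, replaced 2026-08-16T23:42:13Z -> stmt-AtomisticToContinuum-17866): retired by None — (∃ η₀ : ℝ, 0 < η₀ ∧ ∃ F : ℝ → ℝ, AnalyticOnNhd ℝ F (Set.Ioo (-η₀) η₀) ∧ Set.EqOn Literature.MathematicalPhysics.KineticTheory.hsExcessFreeEnergy F (Set.Ico 0 η₀) ∧ F 0 = 0 ∧ deriv F 0 = 2 * Real.pi / 3 ∧ ∀ η ∈ Set.Ico 0 η₀, Filter.Tendsto (fun N :
/-- item stmt-AtomisticToContinuum-17866 · crux · rank 6 · open · by planner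
why it might fail: Fixed-time (in-probability) closure and second law force a Fubini/bad-time-set Gronwall with H_φ bounded on the good box, joint measurability of (τ,z) ↦ Φ_τ z, mollifier-uniform coercivity/relative-flux constants, and isentropy from one-sided PDE clauses — unprinted at finite N.
sources: Dafermos1979, Dafermos2005, BrezinaFeireisl2018, FjordholmEtAl2020, Serfaty2020, HanKwanIacobelli2021
[crux] THE FINITE-N DAFERMOS / MODULATED-ENTROPY GRONWALL, typed as the implication HsEosLowDensity
→ MacroSecondLaw → MomentumFluxLocality → EnergyFluxLocality → NoConcentration →
HydrodynamicLimit-body (the PROVED support HsEosLowDensity inlined verbatim as antecedent 1 —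
`closes` feeds it `HsEosLowDensity_holds`; the conclusion is VERBATIM the packing-guarded
sub-problem decl `HydrodynamicLimit` of the re-type hydro2): ∃η₀ > 0 ∀ continuous positive profiles
∃σ₀ ∀σ < σ₀ ∀ classical hs-Euler solutions on [0,T) with ρσ³ < η₀ throughout ∀ flow families, LLN of
the fields at t = 0 ⇒ LLN at every t < T. Restated 2026-08-16 (route-repair gen 3, gate lint
glue.non-crux-hypothesis) WITHOUT the former antecedent 6 (isentropy of the classical solution = the
support EulerIsentropic inline): that step is now proved INSIDE this crux, the support
EulerIsentropic (C²-F form, provable now, M) staying filed as its pre-cut lemma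
(`EulerIsentropic_holds` once landed) — a strengthening by exactly EulerIsentropic (new → old by
ignoring the antecedent; old ∧ EulerIsentropic → new; both checked in the planner's Sketch.lean), so
`closes` is crux-only. Intended proof (per σ, solution, t, χ, δ): choose th -/
@[route_item "route-AtomisticToContinuum-InvariantGibbsBookkeeping", crux]
def ModulatedEntropyStability : Prop :=
  (∃ η₀ : ℝ, 0 < η₀ ∧ ∃ F : ℝ → ℝ, AnalyticOnNhd ℝ F (Set.Ioo (-η₀) η₀) ∧ Set.EqOn Literature.MathematicalPhysics.KineticTheory.hsExcessFreeEnergy F (Set.Ico 0 η₀) ∧ F 0 = 0 ∧ deriv F 0 = 2 * Real.pi / 3 ∧ ∀ η ∈ Set.Ico 0 η₀, Filter.Tendsto (fun N : ℕ => -(N : ℝ)⁻¹ * Real.log (Literature.MathematicalPhysics.KineticTheory.hsFreeVolume η N)) Filter.atTop (nhds (F η))) → MacroSecondLaw → MomentumFluxLocality → EnergyFluxLocality → NoConcentration → ∃ η₀ : ℝ, 0 < η₀ ∧ ∀ (a₀ θ₀ : UnitAddTorus (Fin 3) → ℝ) (u₀ : UnitAddTorus (Fin 3) → EuclideanSpace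 ℝ (Fin 3)), Continuous a₀ → Continuous θ₀ → Continuous u₀ → (∀ x, 0 < a₀ x) → (∀ x, 0 < θ₀ x) → ∃ σ₀ : ℝ, 0 < σ₀ ∧ ∀ σ : ℝ, 0 < σ → σ < σ₀ → ∀ (T : ℝ) (ρ θ : ℝ → UnitAddTorus (Fin 3) → ℝ) (u : ℝ → UnitAddTorus (Fin 3) → EuclideanSpace ℝ (Fin 3)), Literature.MathematicalPhysics.KineticTheory.IsHardSphereEulerSolution σ T ρ u θ → (∀ t ∈ Set.Ico 0 T, ∀ x, ρ t x * σ ^ 3 < η₀) → ∀ Φ : (N : ℕ) → Literature.Analysis.FluidPDE.HardSphereFlow (Literature.Analysis.FluidPDE.Torus.geometry (Fin 3)) (Literature.MathematicalPhysics.KineticTheory.hsDiameter σ N) (N + 1), Literature.MathematicalPhysics.KineticTheory.TendstoHydroFieldsAt (fun N => Literature.MathematicalPhysics.KineticTheory.localGibbsLaw σ a₀ u₀ θ₀ N (Φ N)) Φ ρ u θ 0 → ∀ t ∈ Set.Ico 0 T, Literature.MathematicalPhysics.KineticTheory.TendstoHydroFieldsAt (fun N => Literature.MathematicalPhysics.KineticTheory.localGibbsLaw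 σ a₀ u₀ θ₀ N (Φ N)) Φ ρ u θ t

/-- item stmt-AtomisticToContinuum-0768 · support · rank 9 · closed · proved by Summit.AtomisticToContinuum.HydrodynamicLimit.Theorems.hsEosLowDensity_proof (prover) · by planner
sources: Ruelle1969, LebowitzPenrose1964
[support] Hard-sphere equation of state at low density: ∃ η₀ > 0 and F real-analytic on (−η₀, η₀)
with hsExcessFreeEnergy = F on [0, η₀), F(0) = 0, F'(0) = 2π/3 (second virial coefficient of
unit-diameter spheres), and the canonical thermodynamic limit −N⁻¹ log hsFreeVolume η N → F(η)
exists (not just limsup) for η ∈ [0, η₀). Ruelle1969 §3.4 (existence), LebowitzPenrose1964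
(convergence of the virial expansion ⇒ analyticity). Makes hsCompressibility/hsPressure smooth and
Z(η) = 1 + (2π/3)η + O(η²); needed by every route (hyperbolicity of the Euler system, virial
theorem). -/
@[route_item "route-AtomisticToContinuum-InvariantGibbsBookkeeping"]
def HsEosLowDensity : Prop :=
  ∃ η₀ : ℝ, 0 < η₀ ∧ ∃ F : ℝ → ℝ, AnalyticOnNhd ℝ F (Set.Ioo (-η₀) η₀) ∧ Set.EqOn Literature.MathematicalPhysics.KineticTheory.hsExcessFreeEnergy F (Set.Ico 0 η₀) ∧ F 0 = 0 ∧ deriv F 0 = 2 * Real.pi / 3 ∧ ∀ η ∈ Set.Ico 0 η₀, Filter.Tendsto (fun N : ℕ => -(N : ℝ)⁻¹ * Real.log (Literature.MathematicalPhysics.KineticTheory.hsFreeVolume η N)) Filter.atTop (nhds (F η))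

/-- `HsEosLowDensity` holds: proved by `Summit.AtomisticToContinuum.HydrodynamicLimit.Theorems.hsEosLowDensity_proof`. -/
theorem HsEosLowDensity_holds : HsEosLowDensity := _root_.Summit.AtomisticToContinuum.HydrodynamicLimit.Theorems.hsEosLowDensity_proof

/-- item stmt-AtomisticToContinuum-13373 · support · rank 9 · open · by planner
sources: GST2013, Alexander1975, Spohn1991
[support] EXACT MASS TRANSPORT (pathwise continuity equation, provable now from the HardSphereFlow
trajectory axioms): for every σ, N, flow Φ, z in the good set, smooth χ and t ≥ 0, D_N(Φ_t z)(χ) −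
D_N(Φ_0 z)(χ) = ∫_0^t Σ_i M_N(Φ_τ z)(∂_iχ)_i dτ — positions are continuous and piecewise affine
(free flight between the locally finite collision times, velocities right-continuous), so τ ↦
χ(x_k(τ)) is Lipschitz with derivative ∇χ(x_k)·v_k(τ) off the collision times; FTC. Feeds the mass
equation (and the density part of L) to the prover of ModulatedEntropyStability. [difficulty: M] -/
@[route_item "route-AtomisticToContinuum-InvariantGibbsBookkeeping"]
def MassTransport : Prop :=
  ∀ (σ : ℝ) (N : ℕ) (Φ : Literature.Analysis.FluidPDE.HardSphereFlow (Literature.Analysis.FluidPDE.Torus.geometry (Fin 3)) (Literature.MathematicalPhysics.KineticTheory.hsDiameter σ N) (N + 1)), ∀ z ∈ Φ.good, ∀ χ : UnitAddTorus (Fin 3) → ℝ, Literature.Analysis.FunctionSpaces.Torus.IsSmooth χ → ∀ t : ℝ, 0 ≤ t → Literature.MathematicalPhysics.KineticTheory.empiricalDensityField (Φ.flow t z) χ - Literature.MathematicalPhysics.KineticTheory.empiricalDensityField (Φ.flow 0 z) χ = ∫ τ in Set.Ioc 0 t, ∑ i, (Literature.MathematicalPhysics.KineticTheory.empiricalMomentumField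 (Φ.flow τ z) (fun y => Literature.Analysis.FunctionSpaces.Torus.partialDeriv i χ y)) i

/-- item stmt-AtomisticToContinuum-13374 · support · rank 9 · open · by planner
sources: Yau1991, OllaVaradhanYau1993, Spohn1991, LebowitzPenrose1964, Ruelle1969
[support] HUB FACT (card (iii)): THE CONJUNCT'S CONCLUSION IMPLIES YAU'S RELATIVE-ENTROPY FORM. For
continuous positive profiles ∃η₀, σ₀ > 0 such that for σ < σ₀, every classical solution (ρ,u,θ) on
[0,T) with packing ρσ³ < η₀, every flow family Φ with local-Gibbs fields converging at t = 0: if the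
fields ALSO converge at time t < T (the conclusion of HydrodynamicLimitFor at t), then there is a
continuous activity profile a > 0 such that the matched local Gibbs laws λ_t^N = localGibbsLaw σ a
(u t) (θ t) N (Φ N) are probability measures and klDiv(lawAt (Φ N) (LG_N) t ‖ λ_t^N)/(N+1) → 0
(Yau1991 form; converse direction of the relative-entropy routes' assembly, so target
RelEntropyVanishing stmt-0766 ⇔ conjunct pre-shock). Proof sketch: H(f_t|ψ_a)/N′ = E_{f_0}Λ₀(U) −
E_{f_t}Λ_a(U) + N′⁻¹log(Z_a/Z₀) exactly (flow invariance, linear tilts); LLN at 0 and t with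
domination by the conserved energy; N′⁻¹log Z → Λ(P) − I(P) by dilute Laplace asymptotics; a =
activity reproducing ρ_t at θ_t; the limit S(P_t) − S(P_0) = 0 by EulerIsentropic. [difficulty: L] -/
@[route_item "route-AtomisticToContinuum-InvariantGibbsBookkeeping"]
def LlnImpliesRelEntropy : Prop :=
  ∀ (a₀ θ₀ : UnitAddTorus (Fin 3) → ℝ) (u₀ : UnitAddTorus (Fin 3) → EuclideanSpace ℝ (Fin 3)), Continuous a₀ → Continuous θ₀ → Continuous u₀ → (∀ x, 0 < a₀ x) → (∀ x, 0 < θ₀ x) → ∃ η₀ : ℝ, 0 < η₀ ∧ ∃ σ₀ : ℝ, 0 < σ₀ ∧ ∀ σ : ℝ, 0 < σ → σ < σ₀ → ∀ (T : ℝ) (ρ θ : ℝ → UnitAddTorus (Fin 3) → ℝ) (u : ℝ → UnitAddTorus (Fin 3) → EuclideanSpace ℝ (Fin 3)), Literature.MathematicalPhysics.KineticTheory.IsHardSphereEulerSolution σ T ρ u θ → (∀ t ∈ Set.Ico 0 T, ∀ x, ρ t x * σ ^ 3 < η₀) → ∀ Φ : (N : ℕ) → Literature.Analysis.FluidPDE.HardSphereFlow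 (Literature.Analysis.FluidPDE.Torus.geometry (Fin 3)) (Literature.MathematicalPhysics.KineticTheory.hsDiameter σ N) (N + 1), Literature.MathematicalPhysics.KineticTheory.TendstoHydroFieldsAt (fun N => Literature.MathematicalPhysics.KineticTheory.localGibbsLaw σ a₀ u₀ θ₀ N (Φ N)) Φ ρ u θ 0 → ∀ t ∈ Set.Ico 0 T, Literature.MathematicalPhysics.KineticTheory.TendstoHydroFieldsAt (fun N => Literature.MathematicalPhysics.KineticTheory.localGibbsLaw σ a₀ u₀ θ₀ N (Φ N)) Φ ρ u θ t → ∃ a : UnitAddTorus (Fin 3) → ℝ, Continuous a ∧ (∀ x, 0 < a x) ∧ (∀ N, MeasureTheory.IsProbabilityMeasure (Literature.MathematicalPhysics.KineticTheory.localGibbsLaw σ a (u t) (θ t) N (Φ N))) ∧ Filter.Tendsto (fun N : ℕ => InformationTheory.klDiv ((Φ N).lawAt (Literature.MathematicalPhysics.KineticTheory.localGibbsLaw σ a₀ u₀ θ₀ N (Φ N)) t) (Literature.MathematicalPhysics.KineticTheory.localGibbsLaw σ a (u t) (θ t) N (Φ N)) / ((N : ENNReal) + 1)) Filter.atTop (nhds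 0)

-- earlier EulerIsentropic (stmt-AtomisticToContinuum-13372, replaced 2026-08-16T23:28:59Z -> stmt-AtomisticToContinuum-17721): retired by None — ∀ (η₀ : ℝ) (F : ℝ → ℝ), 0 < η₀ → ContDiffOn ℝ 1 F (Set.Ioo (-η₀) η₀) → Set.EqOn Literature.MathematicalPhysics.KineticTheory.hsExcessFreeEnergy F (Set.Ico 0 η₀) → ∀ (σ T : ℝ) (ρ θ : ℝ → UnitAddTorus (Fin 3) → ℝ) (u : ℝ → UnitAddTorus (Fin 3) → EuclideanSpac
/-- item stmt-AtomisticToContinuum-17721 · support · rank 9 · open · by planner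
sources: Dafermos2005, Spohn1991
[support] CLASSICAL hs-EULER SOLUTIONS ARE ISENTROPIC WHERE THE EOS IS C² (provable now; re-typed
2026-08-16 from `ContDiffOn ℝ 1 F` to `ContDiffOn ℝ 2 F` on refuter g44-4's flag: with F only C¹ the
pressure ρθ(1 + ρσ³F′(ρσ³)) is merely C⁰ along a smooth solution, so the
`Torus.gradient`/`Torus.divergence` clauses of IsHardSphereEulerSolution are junk equations and the
classical computation below does not type; with C² F the pressure and enthalpy flux are C¹ and it
does): if 0 < η₀, F is C² on (−η₀,η₀) and agrees with hsExcessFreeEnergy on [0,η₀), then for every σ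
> 0 and every IsHardSphereEulerSolution σ T ρ u θ with ρσ³ < η₀ on [0,T)×𝕋³, ∫−ρ_t(3/2 log θ_t − log
ρ_t − hsExcessFreeEnergy(ρ_tσ³))dx is constant in t ∈ [0,T). Proof: on the open interval (0,η₀) ∋
ρσ³ (ρ > 0, σ > 0) hsExcessFreeEnergy = F eventually, so deriv hsExcessFreeEnergy = F′ (C¹), so p =
ρθ(1 + ρσ³F′(ρσ³)) and the Gibbs relation θds = de + p d(1/ρ) (e = 3θ/2) holds; the PDEs give
∂_t(ρs) + div(ρsu) = 0; integrate over 𝕋³ (Torus.integral_divergence_eq_zero), differentiate under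
the integral, vanishing timeDerivWithin on Ico 0 T. [difficulty: M] -/
@[route_item "route-AtomisticToContinuum-InvariantGibbsBookkeeping"]
def EulerIsentropic : Prop :=
  ∀ (η₀ : ℝ) (F : ℝ → ℝ), 0 < η₀ → ContDiffOn ℝ 2 F (Set.Ioo (-η₀) η₀) → Set.EqOn Literature.MathematicalPhysics.KineticTheory.hsExcessFreeEnergy F (Set.Ico 0 η₀) → ∀ (σ T : ℝ) (ρ θ : ℝ → UnitAddTorus (Fin 3) → ℝ) (u : ℝ → UnitAddTorus (Fin 3) → EuclideanSpace ℝ (Fin 3)), 0 < σ → Literature.MathematicalPhysics.KineticTheory.IsHardSphereEulerSolution σ T ρ u θ → (∀ t ∈ Set.Ico 0 T, ∀ x, ρ t x * σ ^ 3 < η₀) → ∀ t ∈ Set.Ico 0 T, ∫ x, -(ρ t x * (3 / 2 * Real.log (θ t x) - Real.log (ρ t x) - Literature.MathematicalPhysics.KineticTheory.hsExcessFreeEnergy (ρ t x * σ ^ 3))) = ∫ x, -(ρ 0 x * (3 / 2 * Real.log (θ 0 x) - Real.log (ρ 0 x) - Literature.MathematicalPhysics.KineticTheory.hsExcessFreeEnergy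 (ρ 0 x * σ ^ 3)))

/-- item stmt-AtomisticToContinuum-9906 · support · rank 9 · closed · proved by Summit.AtomisticToContinuum.HydrodynamicLimit.Theorems.hsEntropyConvex_proof' @ 0cd248dbd2fe (prover) · by planner
sources: Dafermos1979, BrezinaFeireisl2018, Ruelle1969
[support] (ex stmt-AtomisticToContinuum-0817 verbatim; BF18's thermodynamic-stability hypothesis
(WS1) in conserved variables, lemma for RelativeEnergyStability) given the EOS fact, ∃ η₀ > 0 ∀ σ >
0: U = (ρ, m, E) ↦ −ρ(3/2 log θ(U) − log ρ − f_ex(ρσ³)) is strictly convex on the convex set {ρ > 0,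
ρσ³ < η₀, |m|² < 2ρE} ((ηZ)′ > 0 near 0 + perspective argument). [difficulty: M] -/
@[route_item "route-AtomisticToContinuum-InvariantGibbsBookkeeping"]
def HsEntropyConvex : Prop :=
  (∃ η₀ : ℝ, 0 < η₀ ∧ ∃ F : ℝ → ℝ, AnalyticOnNhd ℝ F (Set.Ioo (-η₀) η₀) ∧ Set.EqOn Literature.MathematicalPhysics.KineticTheory.hsExcessFreeEnergy F (Set.Ico 0 η₀) ∧ F 0 = 0 ∧ deriv F 0 = 2 * Real.pi / 3 ∧ ∀ η ∈ Set.Ico 0 η₀, Filter.Tendsto (fun N : ℕ => -(N : ℝ)⁻¹ * Real.log (Literature.MathematicalPhysics.KineticTheory.hsFreeVolume η N)) Filter.atTop (nhds (F η))) → ∃ η₀ : ℝ, 0 < η₀ ∧ ∀ σ : ℝ, 0 < σ → StrictConvexOn ℝ {U : ℝ × Literature.MathematicalPhysics.KineticTheory.V3 × ℝ | 0 < U.1 ∧ U.1 * σ ^ 3 < η₀ ∧ ‖U.2.1‖ ^ 2 < 2 * U.1 * U.2.2} (fun U : ℝ × Literature.MathematicalPhysics.KineticTheory.V3 × ℝ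 => -(U.1 * (3 / 2 * Real.log (2 / 3 * (U.2.2 / U.1 - ‖U.2.1‖ ^ 2 / (2 * U.1 ^ 2))) - Real.log U.1 - Literature.MathematicalPhysics.KineticTheory.hsExcessFreeEnergy (U.1 * σ ^ 3))))

-- earlier Assembly (stmt-AtomisticToContinuum-13375, replaced 2026-08-16T23:23:00Z -> stmt-AtomisticToContinuum-17596): retired by None — HsEosLowDensity → MacroSecondLaw → MomentumFluxLocality → EnergyFluxLocality → NoConcentration → EulerIsentropic → ModulatedEntropyStability → DiluteSelfConsistency → HydrodynamicLimit
-- earlier Assembly (stmt-AtomisticToContinuum-17596, replaced 2026-08-16T23:42:13Z -> stmt-AtomisticToContinuum-17867): retired by None — HsEosLowDensity → MacroSecondLaw → MomentumFluxLocality → EnergyFluxLocality → NoConcentration → EulerIsentropic → ModulatedEntropyStability → HydrodynamicLimit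
/-- item stmt-AtomisticToContinuum-17867 · assembly · rank 1 · open · by planner
sources: Dafermos1979, Spohn1991, OllaVaradhanYau1993
[assembly] MacroSecondLaw → MomentumFluxLocality → EnergyFluxLocality → NoConcentration →
ModulatedEntropyStability → HydrodynamicLimit (the re-typed, packing-guarded sub-problem decl
`_root_.HydrodynamicLimit`); identical in shape to the crux-only deciding theorem `closes`
(route-repair gen 3, 2026-08-16): the proved support HsEosLowDensity is discharged inside by
`HsEosLowDensity_holds` and the isentropy step (support EulerIsentropic) lives inside
ModulatedEntropyStability, so neither is an antecedent; proof = `fun hSL hM hE hNC hStab => hStab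
HsEosLowDensity_holds hSL hM hE hNC`. -/
@[route_item "route-AtomisticToContinuum-InvariantGibbsBookkeeping"]
def Assembly : Prop :=
  MacroSecondLaw → MomentumFluxLocality → EnergyFluxLocality → NoConcentration → ModulatedEntropyStability → HydrodynamicLimit

/-! D-0027 §2.1 — DECIDING THEOREM (planner-authored via `route open/edit --closes-file`; by planner-rbadge-AtomisticToContinuum-InvariantG-86709c6d-0 2026-08-16T23:42:13Z):
its hypotheses are this route's items and its conclusion the sub-problem Statement (glue_lint), and it elaborates with this file. -/

/-- D-0027 §2.1 deciding theorem (route InvariantGibbsBookkeeping, card invariant-gibbs-entropy-bookkeeping),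
CRUX-ONLY since route-repair gen 3 (2026-08-16, gate lint glue.non-crux-hypothesis): the sub-problem decl
`HydrodynamicLimit` (the packing-guarded conjunct, statement re-type hydro2) is VERBATIM the conclusion of
the crux `ModulatedEntropyStability`, whose antecedents are the PROVED support `HsEosLowDensity` (fed here
by its landed witness `HsEosLowDensity_holds` — a lemma invoked inside the term, not a hypothesis) and the
four cruxes `MacroSecondLaw`, `MomentumFluxLocality`, `EnergyFluxLocality`, `NoConcentration`; so the glue
is pure application (δ-unfolding of `HydrodynamicLimit`, `T3`, `V3`). The isentropy of the classical
solution — formerly antecedent 6 of `ModulatedEntropyStability` and hypothesis `hIso : EulerIsentropic` of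
this theorem — is now a step INSIDE the crux's proof; the support `EulerIsentropic` stays filed as its
pre-cut lemma. Hypotheses = the five cruxes, nothing else: `MassTransport`, `HsEntropyConvex`,
`EulerIsentropic` (lemmas for the Gronwall prover) and `LlnImpliesRelEntropy` (hub fact) are deliberately
not hypotheses, and the packing guard is a hypothesis inside the Statement (no `DiluteSelfConsistency`). -/
@[closes "route-AtomisticToContinuum-InvariantGibbsBookkeeping"] theorem closes (hSL : MacroSecondLaw) (hM : MomentumFluxLocality)
    (hE : EnergyFluxLocality) (hNC : NoConcentration)
    (hStab : ModulatedEntropyStability) : _root_.HydrodynamicLimit :=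
  hStab HsEosLowDensity_holds hSL hM hE hNC

end Summit.AtomisticToContinuum.HydrodynamicLimit.Theses.InvariantGibbsBookkeeping
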